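import Summits.CriticalPhenomena.SAWScalingLimit.Theses.SAWLoopFugacityFlow
import Summits.CriticalPhenomena.SAWScalingLimit.Theorems.SAWLoopFugacityFlowAvoidanceDeterminesLawBumps
import Literature.Probability.RandomPlanarGeometry.RestrictionUniqueness
import Literature.Probability.RandomPlanarGeometry.HullRestrictionSLE
import Literature.Probability.RandomPlanarGeometry.CaratheodoryHalfPlaneProofs
import Literature.Probability.RandomPlanarGeometry.ConformalMapCaratheodoryProofs
import Literature.Topology.PlaneTopology.EilenbergCriterion

/-!
# Avoidance determines the law (stmt-CriticalPhenomena-1373): proof of `AvoidanceDeterminesLaw`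

Landing target:
`Summits/CriticalPhenomena/SAWScalingLimit/Theorems/SAWLoopFugacityFlowAvoidanceDeterminesLaw.lean`
(`--workitem stmt-CriticalPhenomena-1373`).

**Theorem** (`AvoidanceDeterminesLaw_proof`, the route item verbatim). Two probability laws on
`CurveClass ℂ` carried by the simple chords of a Dobrushin domain `(D; a, b)` meeting `∂D` only at
`a, b`, which give the same mass to `{trace ⊆ cl D'}` for every Dobrushin `D' ⊆ D` with the same
marked points agreeing with `D` near `a` and `b` (= every hull subdomain,
`MarkedDomain.IsHullSubdomain`), are equal.

**Proof.** Fix a chordal uniformizing map `φ : (ℍ; 0, ∞) → (D; a, b)`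
(`MarkedDomain.exists_isChordalUniformizing_holds`). By the transfer theorem
`CurveClass.Measure.ext_of_missCode_injOn` (Lusin–Souslin, `SimpleCurveLaws`) with the countable
family of image test sets `φ̂(S)` whose avoidance code is injective on the chordal carrier
(`injOn_missCode_imageTest`, `HullRestrictionTests`), it suffices to show that the two laws give
the same mass to `{trace ∩ φ̂(T) = ∅}` for every anchored test set `T` (finite unions of anchored
sets are anchored, `biUnion_anchoredSeq`). If no carried chord avoids `φ̂(T)` both masses vanish.
Otherwise the fill `A = hpFill T` is a `*`-hull avoided by the pulled-back trace `K` of such a chord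
(`isStarHull_hpFill`, `zero_notMem_hpFill_of_disjoint`), and (`measure_rangeSubset_compl_image_eq`)
both masses are the limit of the common masses of the hull-subdomain events `{trace ⊆ cl D'_j}`
for the hull subdomains `D'_j` of `exists_isHullSubdomain_squeeze` (sibling file `…Bumps`): on the
carrier `{trace ∩ φ̂(S_j) = ∅} ⊆ {trace ⊆ cl D'_j} ⊆ {trace ∩ φ̂(T) = ∅}`, where
`S_j = {Im ≥ 0, dist(·, A ∪ [-R, -c] ∪ [c, R]) ≤ c/(j+2)}` decrease and the events
`{trace ∩ φ̂(S_j) = ∅}` increase to `{trace ∩ φ̂(T) = ∅}` (a pulled-back trace avoiding `T` stays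
at positive distance from the compact `A ∪ [-R, -c] ∪ [c, R]`).

This is the planar-topology/measure-theory analogue of [LSW] Lemma 3.2 ("the law of `K` is
determined by `P[K ∩ A = ∅]`") for simple chords of a Jordan domain, as asked by the item.
-/

noncomputable section

open scoped Topology NNReal ENNReal
open Filter Set Metric Bornology MeasureTheory
open Literature.Probability.RandomPlanarGeometry
open UpperHalfPlane (upperHalfPlaneSet isOpen_upperHalfPlaneSet)

namespace Summit.CriticalPhenomena.SAWScalingLimit.Theorems.AvoidanceDeterminesLaw

/-! ### Pulled-back traces inside and outside hull subdomains -/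

section Dictionary

variable {D D' : DobrushinDomain} {φ : ConformalEquiv upperHalfPlaneSet D.carrier}

/-- The pulled-back trace of a curve staying in `cl D'` lies in `closure (φ⁻¹ D')`. [folklore] -/
theorem pullbackTrace_subset_closure_pullbackDomain (hsub : D'.carrier ⊆ D.carrier)
    {c : CurveClass ℂ} (hc : c ∈ CurveClass.rangeSubset (closure D'.carrier)) :
    φ.pullbackTrace c ⊆ closure (φ.pullbackDomain D') := by
  rintro _ ⟨w, ⟨hw, hwD⟩, rfl⟩
  have hz : φ.symm w ∈ upperHalfPlaneSet := φ.symm_mapsTo hwD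
  exact ConformalEquiv.mem_closure_pullbackDomain_of_apply hz hsub
    (by rw [φ.apply_symm_apply hwD]; exact hc hw)

/-- If the pulled-back trace of a carried chord lies in `φ⁻¹ D'` for a hull subdomain `D'`, the
chord stays in `cl D'`. [folklore] -/
theorem mem_rangeSubset_closure_of_pullbackTrace_subset (hD' : D.IsHullSubdomain D')
    {c : CurveClass ℂ} (hc : c ∈ chordalCarrier D) (h : φ.pullbackTrace c ⊆ φ.pullbackDomain D') :
    c ∈ CurveClass.rangeSubset (closure D'.carrier) := by
  have hR : c.range ⊆ D'.carrier ∪ {D'.pt 0, D'.pt 1} := by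
    intro w hw
    rcases hc.2 hw with hwD | hwab
    · left
      have := h ⟨w, ⟨hw, hwD⟩, rfl⟩
      have h2 := this.2
      rwa [φ.apply_symm_apply hwD] at h2
    · right
      rwa [hD'.pt_zero_eq, hD'.pt_one_eq]
  exact subset_closure_of_subset_carrier_union hR

end Dictionary

/-! ### Level sets: a compact exclusion set and the monotone approximation of avoidance -/

/-- The exclusion sets `S_δ = {Im ≥ 0, infDist(·, Q) ≤ δ}` are compact when `Q` is bounded and
nonempty. [folklore] -/
theorem isCompact_levelSet {Q : Set ℂ} (hQb : IsBounded Q) (hQne : Q.Nonempty) (δ : ℝ) :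
    IsCompact {z : ℂ | 0 ≤ z.im ∧ infDist z Q ≤ δ} := by
  refine Metric.isCompact_of_isClosed_isBounded ?_ ?_
  · exact (isClosed_le continuous_const Complex.continuous_im).inter
      (isClosed_le (continuous_infDist_pt Q) continuous_const)
  · obtain ⟨R, hR⟩ := hQb.subset_closedBall 0
    refine (isBounded_closedBall (x := (0 : ℂ)) (r := R + δ + 1)).subset fun z hz ↦ ?_
    obtain ⟨q, hq, hzq⟩ := (infDist_lt_iff hQne).1 (show infDist z Q < δ + 1 by linarith [hz.2])
    have := hR hq
    rw [mem_closedBall, dist_zero_right] at this ⊢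
    calc ‖z‖ ≤ dist z q + ‖q‖ := by rw [dist_eq_norm]; linarith [norm_le_insert' z q]
      _ ≤ R + δ + 1 := by linarith

/-- `{Im ≥ 0} ⊆ closure ℍ`. [folklore] -/
theorem setOf_im_nonneg_subset_closure {z : ℂ} (hz : 0 ≤ z.im) : z ∈ closure upperHalfPlaneSet := by
  rw [show upperHalfPlaneSet = {w : ℂ | 0 < w.im} from rfl, Complex.closure_setOf_lt_im]
  exact hz

/-! ### Agreement on the avoidance event of an anchored test set -/

section Avoid

variable {D : DobrushinDomain} {φ : ConformalEquiv upperHalfPlaneSet D.carrier}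

/-- **Agreement on hull-subdomain events gives agreement on avoidance of anchored test sets.**
Let `μ`, `ν` be finite laws carried by the chordal carrier of `(D; a, b)` which give the same
mass to `{trace ⊆ cl D'}` for every hull subdomain `D'` of `D`, `φ` a chordal uniformizing map
and `T ⊆ ℍ̄` a closed bounded set with `0 ∉ T` and `T ∪ {Im ≤ 0}` connected (an anchored test
set). Then `μ {trace ∩ φ̂(T) = ∅} = ν {trace ∩ φ̂(T) = ∅}` (module docstring, via the squeeze of
`exists_isHullSubdomain_squeeze`).
[cite: LawlerSchrammWerner2003Restriction, Lemma 3.2 (p. 10) with Lemma 2.1 (p. 8), transposed] -/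
theorem measure_rangeSubset_compl_image_eq (hφ : D.IsChordalUniformizing φ)
    {μ ν : Measure (CurveClass ℂ)} [IsFiniteMeasure μ] [IsFiniteMeasure ν]
    (hμ : ∀ᵐ c ∂μ, c ∈ chordalCarrier D) (hν : ∀ᵐ c ∂ν, c ∈ chordalCarrier D)
    (hH : ∀ D' : DobrushinDomain, D.IsHullSubdomain D' →
      μ (CurveClass.rangeSubset (closure D'.carrier)) = ν (CurveClass.rangeSubset (closure D'.carrier)))
    {T : Set ℂ} (hTc : IsClosed T) (hTb : IsBounded T) (hTcl : T ⊆ closure upperHalfPlaneSet)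
    (h0T : (0 : ℂ) ∉ T) (hTconn : IsConnected (T ∪ {z : ℂ | z.im ≤ 0})) :
    μ (CurveClass.rangeSubset (φ.boundaryExtension '' T)ᶜ) =
      ν (CurveClass.rangeSubset (φ.boundaryExtension '' T)ᶜ) := by
  classical
  have hC : JordanDomain.exists_continuousOn_extension := JordanDomain.exists_continuousOn_extension_holds
  have hJarc : Literature.Topology.PlaneTopology.JordanArcSeparation :=
    Literature.Topology.PlaneTopology.JordanArcSeparation_holds
  have hFa : isSimplyConnected_of_isConnected_compl := isSimplyConnected_of_isConnected_compl_holds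
  set Av := CurveClass.rangeSubset (φ.boundaryExtension '' T)ᶜ with hAvdef
  -- trivial case: no carried chord avoids `φ̂(T)`
  by_cases htriv : ∀ c ∈ chordalCarrier D, c ∉ Av
  · have hμ0 : μ Av = 0 := by
      rw [← measure_empty (μ := μ)]
      refine measure_congr ?_
      filter_upwards [hμ] with c hc
      exact propext ⟨fun h ↦ (htriv c hc h).elim, fun h ↦ (Set.notMem_empty c h).elim⟩
    have hν0 : ν Av = 0 := by
      rw [← measure_empty (μ := ν)]
      refine measure_congr ?_
      filter_upwards [hν] with c hc
      exact propext ⟨fun h ↦ (htriv c hc h).elim, fun h ↦ (Set.notMem_empty c h).elim⟩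
    rw [hμ0, hν0]
  push Not at htriv
  obtain ⟨c₀, hc₀, hc₀Av⟩ := htriv
  -- the fill `A` of `T` is a `*`-hull avoided by the pulled-back trace `K` of `c₀`
  have hdisj₀ : Disjoint (φ.pullbackTrace c₀) T :=
    (disjoint_pullbackTrace_iff_mem_rangeSubset hC hφ hc₀ hTcl h0T).2 hc₀Av
  obtain ⟨β, hβc, -, hβ0, hβim, hβinf, hβeq⟩ := exists_simplePath_pullbackTrace hC hφ hc₀
  have hdisjβ : Disjoint (range β) T := by
    refine Set.disjoint_left.2 ?_
    rintro _ ⟨t, rfl⟩ htT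
    rcases eq_or_lt_of_le (show (0 : ℝ≥0) ≤ t from bot_le) with ht | ht
    · rw [← ht, hβ0] at htT
      exact h0T htT
    · exact Set.disjoint_left.1 hdisj₀ (hβeq ▸ ⟨t, ht, rfl⟩) htT
  have h0A : (0 : ℂ) ∉ hpFill T := zero_notMem_hpFill_of_disjoint hTc hβc hβ0 hβim hβinf hdisjβ
  set A : Set ℂ := hpFill T with hAdef
  have hA : IsStarHull A := isStarHull_hpFill hFa hTc hTb hTconn h0A
  have hAc : IsCompact A := hA.isBoundedHull.isCompact
  set K : RestrictionConfig := pullbackConfig hJarc hC hφ c₀ with hKdef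
  have hKco : (K : Set ℂ) = φ.pullbackTrace c₀ := coe_pullbackConfig hc₀
  have hKA : Disjoint (K : Set ℂ) A := by
    rw [hKco, hβeq]
    have := (disjoint_range_hpFill_iff hTc hTb h0T hβc hβ0 hβim hβinf).2 hdisjβ
    exact this.mono_left (image_subset_range _ _)
  -- constants `0 < c ≤ R` with `c ≤ ‖z‖ ≤ R` on `A`
  obtain ⟨c, hc, hcA⟩ : ∃ c : ℝ, 0 < c ∧ ∀ z ∈ A, c ≤ ‖z‖ := by
    obtain ⟨c, hc, hball⟩ := Metric.isOpen_iff.1 hAc.isClosed.isOpen_compl 0 h0A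
    exact ⟨c, hc, fun z hz ↦ not_lt.1 fun hlt ↦ hball (by simpa using hlt) hz⟩
  obtain ⟨R₀, hR₀⟩ := hAc.isBounded.subset_closedBall 0
  set R : ℝ := max R₀ c with hRdef
  have hcR : c ≤ R := le_max_right _ _
  have hnorm : ∀ z ∈ A, c ≤ ‖z‖ ∧ ‖z‖ ≤ R := fun z hz ↦ ⟨hcA z hz, by
    have := hR₀ hz
    rw [mem_closedBall, dist_zero_right] at this
    exact this.trans (le_max_left _ _)⟩
  -- the compact set `Q = A ∪ [-R, -c] ∪ [c, R]` and the level sets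
  set Q : Set ℂ := A ∪ (((↑) : ℝ → ℂ) '' Icc (-R) (-c) ∪ ((↑) : ℝ → ℂ) '' Icc c R) with hQdef
  have hQne : Q.Nonempty := ⟨(c : ℂ), Or.inr (Or.inr ⟨c, ⟨le_rfl, hcR⟩, rfl⟩)⟩
  have hQc : IsCompact Q := hAc.union ((isCompact_Icc.image Complex.continuous_ofReal).union
    (isCompact_Icc.image Complex.continuous_ofReal))
  have hQnorm : ∀ q ∈ Q, c ≤ ‖q‖ := by
    rintro q (hq | ⟨x, hx, rfl⟩ | ⟨x, hx, rfl⟩)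
    · exact hcA q hq
    · rw [Complex.norm_real, Real.norm_eq_abs, abs_of_neg (by linarith [hx.2])]; linarith [hx.2]
    · rw [Complex.norm_real, Real.norm_eq_abs, abs_of_pos (by linarith [hx.1])]; exact hx.1
  have hQim : ∀ q ∈ Q, q ∉ upperHalfPlaneSet → q.im = 0 := by
    rintro q hq hqH
    rcases hq with hq | ⟨x, -, rfl⟩ | ⟨x, -, rfl⟩
    · have := RestrictionConfig.im_nonneg_of_mem_isBoundedHull hA.isBoundedHull hq
      exact le_antisymm (not_lt.1 hqH) this
    · simp
    · simp
  set ε : ℕ → ℝ := fun j ↦ c / (j + 2) with hεdef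
  have hεpos : ∀ j, 0 < ε j := fun j ↦ by positivity
  have hεlt : ∀ j, ε j < c := fun j ↦ by
    show c / (j + 2) < c
    rw [div_lt_iff₀ (by positivity)]
    nlinarith
  have hεanti : Antitone ε := fun i j hij ↦ by
    show c / (j + 2) ≤ c / (i + 2)
    gcongr
  have hεto : Tendsto ε atTop (𝓝 0) := by
    have h1 : Tendsto (fun j : ℕ ↦ ((j : ℝ) + 2)) atTop atTop :=
      tendsto_atTop_add_const_right _ _ tendsto_natCast_atTop_atTop
    simpa using h1.const_div_atTop c
  set S : ℕ → Set ℂ := fun j ↦ {z : ℂ | 0 ≤ z.im ∧ infDist z Q ≤ ε j} with hSdef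
  have hScl : ∀ j, S j ⊆ closure upperHalfPlaneSet := fun j z hz ↦ setOf_im_nonneg_subset_closure hz.1
  have hScpt : ∀ j, IsCompact (S j) := fun j ↦ isCompact_levelSet hQc.isBounded hQne (ε j)
  have h0S : ∀ j, (0 : ℂ) ∉ S j := fun j hz ↦ by
    have : c ≤ infDist (0 : ℂ) Q := (le_infDist hQne).2 fun q hq ↦ by
      rw [dist_zero_left]; exact hQnorm q hq
    linarith [hz.2, hεlt j]
  set Avj : ℕ → Set (CurveClass ℂ) := fun j ↦ CurveClass.rangeSubset (φ.boundaryExtension '' S j)ᶜ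
    with hAvjdef
  have hAvjmono : Monotone Avj := fun i j hij c' hc' w hw hwS ↦ by
    obtain ⟨z, hz, rfl⟩ := hwS
    exact hc' hw ⟨z, ⟨hz.1, hz.2.trans (hεanti hij)⟩, rfl⟩
  -- (U) on the carrier, `Av ⊆ ⋃ⱼ Avj j`
  have hU : ∀ c' ∈ chordalCarrier D, c' ∈ Av → c' ∈ ⋃ j, Avj j := by
    intro c' hc' hc'Av
    set K' : RestrictionConfig := pullbackConfig hJarc hC hφ c' with hK'def
    have hK'co : (K' : Set ℂ) = φ.pullbackTrace c' := coe_pullbackConfig hc'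
    have hdisj' : Disjoint (φ.pullbackTrace c') T :=
      (disjoint_pullbackTrace_iff_mem_rangeSubset hC hφ hc' hTcl h0T).2 hc'Av
    -- `closure K' ∩ Q = ∅`
    have hdisjA : Disjoint (φ.pullbackTrace c') A := by
      obtain ⟨β', hβc', -, hβ0', hβim', hβinf', hβeq'⟩ := exists_simplePath_pullbackTrace hC hφ hc'
      have hdβ : Disjoint (range β') T := by
        refine Set.disjoint_left.2 ?_
        rintro _ ⟨t, rfl⟩ htT
        rcases eq_or_lt_of_le (show (0 : ℝ≥0) ≤ t from bot_le) with ht | ht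
        · rw [← ht, hβ0'] at htT
          exact h0T htT
        · exact Set.disjoint_left.1 hdisj' (hβeq' ▸ ⟨t, ht, rfl⟩) htT
      rw [hβeq']
      exact ((disjoint_range_hpFill_iff hTc hTb h0T hβc' hβ0' hβim' hβinf').2 hdβ).mono_left
        (image_subset_range _ _)
    have hdisjQ : Disjoint (closure (K' : Set ℂ)) Q := by
      rw [K'.closure_eq, hK'co]
      refine Set.disjoint_left.2 ?_
      rintro z (hz | hz) hzQ
      · rcases hzQ with hzA | hzband
        · exact Set.disjoint_left.1 hdisjA hz hzA
        · have hzH : z ∈ upperHalfPlaneSet := ConformalEquiv.pullbackTrace_subset _ hz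
          have : z.im = 0 := by
            rcases hzband with ⟨x, -, rfl⟩ | ⟨x, -, rfl⟩ <;> simp
          exact absurd hzH (by simp [upperHalfPlaneSet, this])
      · rw [mem_singleton_iff] at hz
        subst hz
        have := hQnorm 0 hzQ
        simp at this
        linarith
    -- a uniform positive distance
    obtain ⟨δ, hδ, hδQ⟩ : ∃ δ : ℝ, 0 < δ ∧ ∀ q ∈ Q, δ ≤ infDist q (closure (K' : Set ℂ)) := by
      have hcont : ContinuousOn (fun q ↦ infDist q (closure (K' : Set ℂ))) Q :=
        (continuous_infDist_pt _).continuousOn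
      obtain ⟨q₀, hq₀, hmin⟩ := hQc.exists_isMinOn hQne hcont
      refine ⟨infDist q₀ (closure (K' : Set ℂ)), ?_, fun q hq ↦ hmin hq⟩
      have hne : (closure (K' : Set ℂ)).Nonempty := ⟨0, K'.zero_mem_closure⟩
      exact (isClosed_closure.notMem_iff_infDist_pos hne).1
        (fun h ↦ Set.disjoint_left.1 hdisjQ h hq₀)
    obtain ⟨j, hj⟩ : ∃ j : ℕ, ε j < δ := ((tendsto_order.1 hεto).2 δ hδ).exists
    refine mem_iUnion.2 ⟨j, ?_⟩
    refine (disjoint_pullbackTrace_iff_mem_rangeSubset hC hφ hc' (hScl j) (h0S j)).1 ?_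
    refine Set.disjoint_left.2 fun z hz hzS ↦ ?_
    have hzK : z ∈ closure (K' : Set ℂ) := by rw [hK'co] at *; exact subset_closure hz
    have h1 : δ ≤ infDist z Q := (le_infDist hQne).2 fun q hq ↦ by
      rw [dist_comm]
      exact (hδQ q hq).trans (infDist_le_dist_of_mem hzK)
    linarith [hzS.2]
  -- (L) for each `j`, a hull subdomain squeezed between `Avj j` and `Av`
  have hL : ∀ j, ∃ D' : DobrushinDomain, D.IsHullSubdomain D' ∧
      (∀ c' ∈ chordalCarrier D, c' ∈ CurveClass.rangeSubset (closure D'.carrier) → c' ∈ Av) ∧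
      (∀ c' ∈ chordalCarrier D, c' ∈ Avj j → c' ∈ CurveClass.rangeSubset (closure D'.carrier)) := by
    intro j
    obtain ⟨D', hD', hoff, hfar⟩ := exists_isHullSubdomain_squeeze hφ hA K hKA hc hnorm (hεpos j)
    refine ⟨D', hD', fun c' hc' hV ↦ ?_, fun c' hc' hAv ↦ ?_⟩
    · refine (disjoint_pullbackTrace_iff_mem_rangeSubset hC hφ hc' hTcl h0T).1 ?_
      refine Set.disjoint_left.2 fun z hz hzT ↦ ?_
      have hzH : z ∈ upperHalfPlaneSet := ConformalEquiv.pullbackTrace_subset _ hz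
      have hzA : z ∈ A := inter_subset_hpFill T ⟨hzT, hzH⟩
      exact Set.disjoint_left.1 hoff ⟨hzA, hzH⟩
        (pullbackTrace_subset_closure_pullbackDomain hD'.carrier_subset hV hz)
    · refine mem_rangeSubset_closure_of_pullbackTrace_subset (φ := φ) hD' hc' fun z hz ↦ ?_
      have hzH : z ∈ upperHalfPlaneSet := ConformalEquiv.pullbackTrace_subset _ hz
      have hdS : Disjoint (φ.pullbackTrace c') (S j) :=
        (disjoint_pullbackTrace_iff_mem_rangeSubset hC hφ hc' (hScl j) (h0S j)).2 hAv
      refine hfar z hzH (not_lt.1 fun hlt ↦ Set.disjoint_left.1 hdS hz ⟨?_, hlt.le⟩)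
      exact le_of_lt (show (0 : ℝ) < z.im from hzH)
  choose Dj hDj hDjAv hAvjDj using hL
  -- the squeeze of measures
  have key : ∀ (ρ : Measure (CurveClass ℂ)), (∀ᵐ c' ∂ρ, c' ∈ chordalCarrier D) →
      (∀ j, ρ (Avj j) ≤ ρ (CurveClass.rangeSubset (closure (Dj j).carrier))) ∧
      (∀ j, ρ (CurveClass.rangeSubset (closure (Dj j).carrier)) ≤ ρ Av) ∧
      ρ Av ≤ ⨆ j, ρ (Avj j) := by
    intro ρ hρ
    refine ⟨fun j ↦ measure_mono_ae ?_, fun j ↦ measure_mono_ae ?_, ?_⟩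
    · filter_upwards [hρ] with c' hc' h using hAvjDj j c' hc' h
    · filter_upwards [hρ] with c' hc' h using hDjAv j c' hc' h
    · rw [← hAvjmono.measure_iUnion]
      refine measure_mono_ae ?_
      filter_upwards [hρ] with c' hc' h using hU c' hc' h
  obtain ⟨hμ1, hμ2, hμ3⟩ := key μ hμ
  obtain ⟨hν1, hν2, hν3⟩ := key ν hν
  have hDjeq : ∀ j, μ (CurveClass.rangeSubset (closure (Dj j).carrier)) =
      ν (CurveClass.rangeSubset (closure (Dj j).carrier)) := fun j ↦ hH (Dj j) (hDj j)
  refine le_antisymm ?_ ?_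
  · refine hμ3.trans (iSup_le fun j ↦ ?_)
    calc μ (Avj j) ≤ μ (CurveClass.rangeSubset (closure (Dj j).carrier)) := hμ1 j
      _ = ν (CurveClass.rangeSubset (closure (Dj j).carrier)) := hDjeq j
      _ ≤ ν Av := hν2 j
  · refine hν3.trans (iSup_le fun j ↦ ?_)
    calc ν (Avj j) ≤ ν (CurveClass.rangeSubset (closure (Dj j).carrier)) := hν1 j
      _ = μ (CurveClass.rangeSubset (closure (Dj j).carrier)) := (hDjeq j).symm
      _ ≤ μ Av := hμ2 j

end Avoid

/-! ### The route item -/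

/-- From `a ∉ closure (D ∖ D')` (hull subdomain) to the item's form "`D'` agrees with `D` on a
ball about `a`". [folklore] -/
theorem exists_inter_ball_eq {D D' : MarkedDomain 2} (h : D.IsHullSubdomain D') :
    ∃ ε : ℝ, 0 < ε ∧ D'.carrier ∩ ball (D.pt 0) ε = D.carrier ∩ ball (D.pt 0) ε ∧
      D'.carrier ∩ ball (D.pt 1) ε = D.carrier ∩ ball (D.pt 1) ε := by
  obtain ⟨ε₀, hε₀, hb₀⟩ := Metric.isOpen_iff.1 isClosed_closure.isOpen_compl _ h.pt_zero_notMem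
  obtain ⟨ε₁, hε₁, hb₁⟩ := Metric.isOpen_iff.1 isClosed_closure.isOpen_compl _ h.pt_one_notMem
  refine ⟨min ε₀ ε₁, lt_min hε₀ hε₁, ?_, ?_⟩
  · refine Subset.antisymm (inter_subset_inter_left _ h.carrier_subset) fun z ⟨hzD, hzb⟩ ↦ ⟨?_, hzb⟩
    by_contra hzD'
    exact hb₀ (ball_subset_ball (min_le_left _ _) hzb) (subset_closure ⟨hzD, hzD'⟩)
  · refine Subset.antisymm (inter_subset_inter_left _ h.carrier_subset) fun z ⟨hzD, hzb⟩ ↦ ⟨?_, hzb⟩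
    by_contra hzD'
    exact hb₁ (ball_subset_ball (min_le_right _ _) hzb) (subset_closure ⟨hzD, hzD'⟩)

/-- **Avoidance determines the law** (item stmt-CriticalPhenomena-1373 of route
`SAWLoopFugacityFlow`, shared with the other SAW routes): two probability measures on
`CurveClass ℂ` carried by simple chords of the Dobrushin domain `D` from `a` to `b` meeting `∂D`
only at `a, b`, which give the same mass to `{range ⊆ closure D'}` for every Dobrushin `D' ⊆ D`
with the same marked points and agreeing with `D` near `a` and `b`, are equal (module
docstring for the proof). [cite: LawlerSchrammWerner2003Restriction, Lemma 3.2 (p. 10) with Lemma 2.1 (p. 8), transposed to simple chords of a Jordan domain] -/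
theorem AvoidanceDeterminesLaw_proof :
    Summit.CriticalPhenomena.SAWScalingLimit.Theses.SAWLoopFugacityFlow.AvoidanceDeterminesLaw := by
  intro D μ ν hμP hνP hμcar hνcar hagree
  classical
  have hC : JordanDomain.exists_continuousOn_extension := JordanDomain.exists_continuousOn_extension_holds
  have hJarc : Literature.Topology.PlaneTopology.JordanArcSeparation :=
    Literature.Topology.PlaneTopology.JordanArcSeparation_holds
  obtain ⟨φ, hφ⟩ := MarkedDomain.exists_isChordalUniformizing_holds D
  -- both laws are carried by the chordal carrier
  have hcar : ∀ {ρ : Measure (CurveClass ℂ)}, (∀ᵐ γ ∂ρ, γ ∈ CurveClass.simple ∧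
      γ.source = D.pt 0 ∧ γ.target = D.pt 1 ∧ γ.range ⊆ closure D.carrier ∧
      γ.range ∩ frontier D.carrier ⊆ {D.pt 0, D.pt 1}) → ∀ᵐ γ ∂ρ, γ ∈ chordalCarrier D := by
    intro ρ h
    filter_upwards [h] with γ hγ
    exact ⟨⟨⟨hγ.1, hγ.2.1⟩, hγ.2.2.1⟩, subset_carrier_union_of_inter_frontier hγ.2.2.2.1 hγ.2.2.2.2⟩
  have hμc := hcar hμcar
  have hνc := hcar hνcar
  -- agreement on hull-subdomain events
  have hH : ∀ D' : DobrushinDomain, D.IsHullSubdomain D' →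
      μ (CurveClass.rangeSubset (closure D'.carrier)) = ν (CurveClass.rangeSubset (closure D'.carrier)) :=
    fun D' hD' ↦ hagree D' hD'.carrier_subset hD'.pt_zero_eq hD'.pt_one_eq (exists_inter_ball_eq hD')
  -- transfer through the anchored test sets
  refine CurveClass.Measure.ext_of_missCode_injOn (fun n ↦ isClosed_imageTest hC n)
    measurableSet_chordalCarrier (injOn_missCode_imageTest hJarc hC hφ) hμc hνc fun s ↦ ?_
  obtain ⟨hanch, hcpt, hcl, h0⟩ := biUnion_anchoredSeq s
  rw [biUnion_imageTest]
  set T : Set ℂ := ⋃ n ∈ s, anchoredSeq n with hT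
  rcases hanch with hempty | hanch
  · rw [hempty, image_empty]
    have : (CurveClass.rangeSubset (∅ : Set ℂ)ᶜ : Set (CurveClass ℂ)) = univ := by
      ext c; simp [CurveClass.mem_rangeSubset]
    rw [this, measure_univ, measure_univ]
  · exact measure_rangeSubset_compl_image_eq hφ hμc hνc hH hcpt.isClosed hcpt.isBounded hcl h0 hanch.2

end Summit.CriticalPhenomena.SAWScalingLimit.Theorems.AvoidanceDeterminesLaw

end
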